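import Literature.NumberTheory.Sieve.MoebiusShiftedPrimesDirichletMeanValue33
import HarnessLib

/-!
# Möbius on shifted primes — Proposition 3.4 of Lichtman 2020 at the printed first exponent, all window lengths

Topic `Literature/NumberTheory/Sieve`, part of the decomposition of the named fact
`Literature.NumberTheory.Sieve.Lichtman2020_keyFourierEstimateLiouville` (J. D. Lichtman, *Averages of
the Möbius function on shifted primes*, Q. J. Math. 73 (2022) 729–757, arXiv:2009.08969v2
[Lichtman2020], Proposition 2.3 AS PRINTED), second layer after
`MoebiusShiftedPrimesDirichletMeanValue33.lean` (Proposition 5.1 at the printed `P₁ = (log X)^{cA}`,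
`c ≥ 33`, saving `(log X)^{-3A}`).  Page numbers refer to the held copy `paper:arxiv-2009.08969`.

This file PROVES the mean-square bound of Proposition 3.4 (p. 10) along `S_c`, `c ≥ 33`, in the
printed regime `ψ(X) ≤ (log X)^{2/3}`, for EVERY window length `1 ≤ h ≤ H` and with the dependence
on `h` that the printed deduction (p. 14, (5.4)–(5.6)) actually gives:

* `Lichtman2020.liouvilleMeanSquare33` — PROVED from `Lichtman2020_primeCharacterSum` (Lemma 4.5) and
  `Lichtman2020_liouvilleCharacterSifted` (Lemma 4.8, itself proved in the tree): for `q ≤ (log X)^A`,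
  `χ (mod q)`, `1 ≤ h ≤ H`, `Y ∈ [X/(log X)^{6A}, 2X]`,
  `∫_Y^{2Y} |∑_{x ≤ m ≤ x+h, m ∈ S_c} λ(m)χ(m)|² dx ≤ C (h² Y (Q₁/h + 1)(log X)^{-3A} + hY)`,
  `Q₁ = H/(log X)^{4A}` — i.e. `J ≪ (Q₁/h₁ + 1)(log X)^{-B} + 1/h₁` in the notation of (5.6), with
  `B = 3A`.  (The tree's `Lichtman2020_liouvilleMeanSquareWith` is the case `h ≥ H/W⁵`, `B = 11A`,
  `c ≥ 100`, where `Q₁/h ≤ W` is absorbed into `W^{-10}`.)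

The major arcs at the printed first exponent (`MoebiusShiftedPrimesMajorArcs33.lean`) consume this
bound at window lengths `h ≍ W^{-1/5}/|θ| ≥ W^{-1/5} qH/W⁴`, where `Q₁/h ≤ W^{1/5}`.

## The proof (p. 14, as in `MoebiusShiftedPrimesMeanSquare.lean`)

The tree's skeleton `Lichtman2020.meanSquare_le_of_pieces_trunc` (Lemma 4.6 Parseval + Lemma 4.1,
proved) with `ℓ = log X`, `T₀ = ℓ^{6A}`, `h₂ = Y/T₀³`, the two Proposition-5.1 bounds for `χ`, `χ̄`
at the scale `Y` (`dirichletMeanValue33`), and the long windows `|S_{h₂}(x)| ≤ 24 C₈ Y/(ℓ/2)^{20A}` from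
Lemma 4.8 with `(2A, 20A)` for `(A, K)` (`lemma48_at_points'`, the tree's `norm_longWindow_le`); then
`24·2431² h²Y (2000/T₀² + 36C₅(Q₁/h+1)ℓ^{-3A} + 2000/h + 4/Y) + 2(24C₈2^{20A})² h²Y ℓ^{-4A}
≤ C (h²Y(Q₁/h+1)ℓ^{-3A} + hY)` (`numerics33_final`, using `h ≤ Y`).  The regime enters through
`H ≤ exp(ℓ^{3/4})` (`eventually_H_le_exp_of_psi`).

## Faithfulness notes

* Proposition 3.4 is printed for `h ∈ [H/W⁵, H]` with the bound `Y/W^{10}` (normalised); here the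
  window length is free and the bound is the one the printed proof yields before the last line of
  (5.6) (`(Q₁/h₁ + 1)(log X)^{-B} + Y/(h₁X)`-shaped), with `B = 3A` at the printed `P₁` (see
  `MoebiusShiftedPrimesDirichletMeanValue33.lean`); rendering as in the tree's
  `Lichtman2020_liouvilleMeanSquare` (`X : ℕ`, `H : ℕ → ℕ`, cut-off-free `S_d`), with the range
  `Y ∈ [X/W⁶, 2X]` (the shifted sub-windows of the major arcs start up to `X + H ≤ 2X`).
* No new definition and no named fact is introduced.

## Source

* J. D. Lichtman, arXiv:2009.08969v2: Proposition 3.4 (p. 10); "Proof of Proposition 3.4 from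
  Proposition 5.1", (5.1)–(5.6), p. 14; Lemma 4.8, pp. 12–13; Lemmas 4.1, 4.6, p. 12 [Lichtman2020].
-/

noncomputable section

open Filter Asymptotics Finset MeasureTheory
open scoped Topology

namespace Literature.NumberTheory.Sieve

namespace Lichtman2020

open ArithmeticFunction

/-! ### Numerics in `ℓ = log X` with `T₀ = ℓ^{6A}`, `K = 20A` -/

/-- The long-window term: `(h/h₂)² η² Y = (24 C₈ 2^{20A})² h² Y ℓ^{-4A}` for `h₂ = Y/ℓ^{18A}`,
`η = 24 C₈ Y/(ℓ/2)^{20A}`. [folklore] -/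
theorem numerics_eta33 {ℓ A C₈ h Y : ℝ} (hℓ : 1 ≤ ℓ) (hY : 0 < Y) :
    2 * (h / (Y / (ℓ ^ (6 * A)) ^ 3)) ^ 2 * (24 * C₈ * Y / (ℓ / 2) ^ (20 * A)) ^ 2 * Y =
      2 * (24 * C₈ * 2 ^ (20 * A)) ^ 2 * (h ^ 2 * Y * (1 / ℓ ^ (4 * A))) := by
  have hℓ0 : 0 < ℓ := by linarith
  have e1 : (ℓ ^ (6 * A)) ^ 3 = ℓ ^ (18 * A) := by
    rw [← Real.rpow_natCast, ← Real.rpow_mul hℓ0.le]; ring_nf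
  have e2 : (ℓ / 2) ^ (20 * A) = ℓ ^ (20 * A) / 2 ^ (20 * A) := Real.div_rpow hℓ0.le (by norm_num) _
  have h18 : 0 < ℓ ^ (18 * A) := Real.rpow_pos_of_pos hℓ0 _
  have h20 : 0 < ℓ ^ (20 * A) := Real.rpow_pos_of_pos hℓ0 _
  have h4 : 0 < ℓ ^ (4 * A) := Real.rpow_pos_of_pos hℓ0 _
  have h2 : (0 : ℝ) < 2 ^ (20 * A) := Real.rpow_pos_of_pos (by norm_num) _
  have e3 : (ℓ ^ (18 * A)) ^ 2 * ℓ ^ (4 * A) = (ℓ ^ (20 * A)) ^ 2 := by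
    rw [← Real.rpow_natCast, ← Real.rpow_natCast (ℓ ^ (20 * A)), ← Real.rpow_mul hℓ0.le,
      ← Real.rpow_mul hℓ0.le, ← Real.rpow_add hℓ0]
    ring_nf
  rw [e1, e2]
  field_simp
  rw [show A * 4 = 4 * A by ring, show A * 20 = 20 * A by ring, ← e3]
  ring

/-- The final real arithmetic of this layer: with `u = h²Y(Q/h+1)/ℓ^{3A}`, `v = hY`,
`24·2431² h²Y (2000/(ℓ^{6A})² + 36C₅(Q/h+1)/ℓ^{3A} + 2000/h + 4/Y) + E h²Y ℓ^{-4A}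
≤ (24·2431²(4004 + 36C₅) + E)(u + v)` (`ℓ, h ≥ 1`, `h ≤ Y`, `C₅, Q, E ≥ 0`). [folklore] -/
theorem numerics33_final {ℓ A h Y C₅ Q E : ℝ} (hℓ : 1 ≤ ℓ) (hA : 0 ≤ A) (hh : 1 ≤ h) (hhY : h ≤ Y)
    (hC₅ : 0 ≤ C₅) (hQ : 0 ≤ Q) (hE : 0 ≤ E) :
    24 * 2431 ^ 2 * h ^ 2 * Y * (2000 / (ℓ ^ (6 * A)) ^ 2 + 36 * C₅ * (Q / h + 1) * (1 / ℓ ^ (3 * A))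
        + 2000 / h + 4 / Y) + E * (h ^ 2 * Y * (1 / ℓ ^ (4 * A))) ≤
      (24 * 2431 ^ 2 * (4004 + 36 * C₅) + E) *
        (h ^ 2 * Y * (Q / h + 1) / ℓ ^ (3 * A) + h * Y) := by
  have hℓ0 : 0 < ℓ := by linarith
  have hh0 : 0 < h := by linarith
  have hY0 : 0 < Y := by linarith
  have h3 : 0 < ℓ ^ (3 * A) := Real.rpow_pos_of_pos hℓ0 _
  have h31 : 1 ≤ ℓ ^ (3 * A) := Real.one_le_rpow hℓ (by positivity)
  set s : ℝ := 1 / ℓ ^ (3 * A) with hs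
  have hs0 : 0 < s := by positivity
  have hs1 : s ≤ 1 := by rw [hs, div_le_one h3]; exact h31
  have hR1 : 1 ≤ Q / h + 1 := by
    have : 0 ≤ Q / h := by positivity
    linarith
  set u : ℝ := h ^ 2 * Y * (Q / h + 1) / ℓ ^ (3 * A) with hu
  have hu' : u = h ^ 2 * Y * ((Q / h + 1) * s) := by rw [hu, hs]; ring
  have hu0 : 0 ≤ u := by rw [hu]; positivity
  have hv0 : 0 ≤ h * Y := by positivity
  have hhY2 : 0 ≤ h ^ 2 * Y := by positivity
  -- (i) `1/(ℓ^{6A})² ≤ (Q/h+1) s`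
  have hi : 2000 / (ℓ ^ (6 * A)) ^ 2 ≤ 2000 * ((Q / h + 1) * s) := by
    have e : (ℓ ^ (6 * A)) ^ 2 = ℓ ^ (12 * A) := by
      rw [← Real.rpow_natCast, ← Real.rpow_mul hℓ0.le]; ring_nf
    rw [e, div_eq_mul_one_div]
    refine mul_le_mul_of_nonneg_left ?_ (by norm_num)
    have h12 : 1 / ℓ ^ (12 * A) ≤ s := by
      rw [hs]
      exact one_div_le_one_div_of_le h3 (Real.rpow_le_rpow_of_exponent_le hℓ (by nlinarith))
    calc 1 / ℓ ^ (12 * A) ≤ s := h12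
      _ = 1 * s := (one_mul s).symm
      _ ≤ (Q / h + 1) * s := mul_le_mul_of_nonneg_right hR1 hs0.le
  -- (iv) `1/ℓ^{4A} ≤ (Q/h+1) s`
  have hiv : 1 / ℓ ^ (4 * A) ≤ (Q / h + 1) * s := by
    have h4 : 1 / ℓ ^ (4 * A) ≤ s := by
      rw [hs]
      exact one_div_le_one_div_of_le h3 (Real.rpow_le_rpow_of_exponent_le hℓ (by nlinarith))
    calc 1 / ℓ ^ (4 * A) ≤ s := h4
      _ = 1 * s := (one_mul s).symm
      _ ≤ (Q / h + 1) * s := mul_le_mul_of_nonneg_right hR1 hs0.le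
  -- (ii)+(iii) `h²Y(2000/h + 4/Y) ≤ 2004 hY`
  have hii : h ^ 2 * Y * (2000 / h + 4 / Y) ≤ 2004 * (h * Y) := by
    have e : h ^ 2 * Y * (2000 / h + 4 / Y) = 2000 * (h * Y) + 4 * (h * h) := by
      field_simp
    rw [e]
    nlinarith [mul_le_mul_of_nonneg_left hhY hh0.le]
  -- assemble
  have hmain : 24 * 2431 ^ 2 * h ^ 2 * Y * (2000 / (ℓ ^ (6 * A)) ^ 2 + 36 * C₅ * (Q / h + 1) * (1 / ℓ ^ (3 * A))
        + 2000 / h + 4 / Y) ≤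
      24 * 2431 ^ 2 * ((2000 + 36 * C₅) * u + 2004 * (h * Y)) := by
    have e1 : 24 * 2431 ^ 2 * h ^ 2 * Y * (2000 / (ℓ ^ (6 * A)) ^ 2 + 36 * C₅ * (Q / h + 1) * (1 / ℓ ^ (3 * A))
        + 2000 / h + 4 / Y) =
        24 * 2431 ^ 2 * (h ^ 2 * Y * (2000 / (ℓ ^ (6 * A)) ^ 2) + 36 * C₅ * u
          + h ^ 2 * Y * (2000 / h + 4 / Y)) := by
      rw [hu', ← hs]; ring
    rw [e1]
    refine mul_le_mul_of_nonneg_left ?_ (by norm_num)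
    have t1 : h ^ 2 * Y * (2000 / (ℓ ^ (6 * A)) ^ 2) ≤ 2000 * u := by
      calc h ^ 2 * Y * (2000 / (ℓ ^ (6 * A)) ^ 2) ≤ h ^ 2 * Y * (2000 * ((Q / h + 1) * s)) :=
            mul_le_mul_of_nonneg_left hi hhY2
        _ = 2000 * u := by rw [hu']; ring
    nlinarith
  have heta : E * (h ^ 2 * Y * (1 / ℓ ^ (4 * A))) ≤ E * u := by
    refine mul_le_mul_of_nonneg_left ?_ hE
    calc h ^ 2 * Y * (1 / ℓ ^ (4 * A)) ≤ h ^ 2 * Y * ((Q / h + 1) * s) :=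
          mul_le_mul_of_nonneg_left hiv hhY2
      _ = u := by rw [hu']
  have hfin : 24 * 2431 ^ 2 * ((2000 + 36 * C₅) * u + 2004 * (h * Y)) + E * u ≤
      (24 * 2431 ^ 2 * (4004 + 36 * C₅) + E) * (u + h * Y) := by nlinarith
  linarith

/-! ### Parameter inequalities in the printed regime (`H ≤ exp(ℓ^{3/4})`) -/

/-- `h ≤ h₂ = Y/T₀³`, `T₀ = ℓ^{6A}`: from `h ≤ H ≤ exp(ℓ^{3/4})`, `Y ≥ X/ℓ^{6A}`,
`ℓ^{3/4} + 24A log ℓ ≤ ℓ`. [folklore] -/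
theorem h_le_h₂33 {X ℓ A Hx h Y : ℝ} (hX : Real.exp ℓ = X) (hℓ : 1 ≤ ℓ) (hh : h ≤ Hx)
    (hHx : Hx ≤ Real.exp (ℓ ^ (3 / 4 : ℝ))) (hY : X / ℓ ^ (6 * A) ≤ Y)
    (hG : ℓ ^ (3 / 4 : ℝ) + 24 * A * Real.log ℓ ≤ ℓ) : h ≤ Y / (ℓ ^ (6 * A)) ^ 3 := by
  have hℓ0 : 0 < ℓ := by linarith
  have e1 : (ℓ ^ (6 * A)) ^ 3 = ℓ ^ (18 * A) := by
    rw [← Real.rpow_natCast, ← Real.rpow_mul hℓ0.le]; ring_nf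
  have h18 : 0 < ℓ ^ (18 * A) := Real.rpow_pos_of_pos hℓ0 _
  have h6 : 0 < ℓ ^ (6 * A) := Real.rpow_pos_of_pos hℓ0 _
  rw [e1]
  have h1 : X / ℓ ^ (6 * A) / ℓ ^ (18 * A) ≤ Y / ℓ ^ (18 * A) :=
    div_le_div_of_nonneg_right hY h18.le
  refine le_trans ?_ h1
  rw [div_div, ← Real.rpow_add hℓ0, show 6 * A + 18 * A = 24 * A by ring,
    div_rpow_log_eq_exp hX hℓ0]
  exact hh.trans (hHx.trans (Real.exp_le_exp.2 (by linarith)))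

/-- `T₀ = ℓ^{6A} ≤ Y/h`: from `h ≤ exp(ℓ^{3/4})`, `Y ≥ X/ℓ^{6A}`, `ℓ^{3/4} + 24A log ℓ ≤ ℓ`. [folklore] -/
theorem T₀_le_U33 {X ℓ A Hx h Y : ℝ} (hX : Real.exp ℓ = X) (hℓ : 1 ≤ ℓ) (hA : 0 ≤ A) (hh0 : 0 < h)
    (hh : h ≤ Hx) (hHx : Hx ≤ Real.exp (ℓ ^ (3 / 4 : ℝ))) (hY : X / ℓ ^ (6 * A) ≤ Y)
    (hG : ℓ ^ (3 / 4 : ℝ) + 24 * A * Real.log ℓ ≤ ℓ) : ℓ ^ (6 * A) ≤ Y / h := by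
  have hℓ0 : 0 < ℓ := by linarith
  have hlogℓ : 0 ≤ Real.log ℓ := Real.log_nonneg hℓ
  have h6 : 0 < ℓ ^ (6 * A) := Real.rpow_pos_of_pos hℓ0 _
  have hX0 : 0 < X := by rw [← hX]; exact Real.exp_pos _
  have hE : h ≤ Real.exp (ℓ ^ (3 / 4 : ℝ)) := hh.trans hHx
  have h1 : X / ℓ ^ (6 * A) / Real.exp (ℓ ^ (3 / 4 : ℝ)) ≤ Y / h := by
    calc X / ℓ ^ (6 * A) / Real.exp (ℓ ^ (3 / 4 : ℝ)) ≤ Y / Real.exp (ℓ ^ (3 / 4 : ℝ)) :=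
          div_le_div_of_nonneg_right hY (Real.exp_pos _).le
      _ ≤ Y / h := div_le_div_of_nonneg_left (by
          have : 0 < X / ℓ ^ (6 * A) := by positivity
          linarith) hh0 hE
  refine le_trans ?_ h1
  rw [div_rpow_log_eq_exp hX hℓ0, ← Real.exp_sub, Real.rpow_def_of_pos hℓ0]
  exact Real.exp_le_exp.2 (by nlinarith)

/-- `√Y ≤ Y/h`: from `h ≤ exp(ℓ^{3/4})`, `Y ≥ X/ℓ^{6A}`, `log 2 + 2ℓ^{3/4} + 6A log ℓ ≤ ℓ`. [folklore] -/
theorem sqrt_le_U33 {X ℓ A Hx h Y : ℝ} (hX : Real.exp ℓ = X) (hℓ : 1 ≤ ℓ) (hh0 : 0 < h)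
    (hh : h ≤ Hx) (hHx : Hx ≤ Real.exp (ℓ ^ (3 / 4 : ℝ))) (hY : X / ℓ ^ (6 * A) ≤ Y)
    (hG : Real.log 2 + 2 * ℓ ^ (3 / 4 : ℝ) + 6 * A * Real.log ℓ ≤ ℓ) :
    Y ^ (1 / 2 : ℝ) ≤ Y / h := by
  have hℓ0 : 0 < ℓ := by linarith
  have h6 : 0 < ℓ ^ (6 * A) := Real.rpow_pos_of_pos hℓ0 _
  have hX0 : 0 < X := by rw [← hX]; exact Real.exp_pos _
  have hY0 : 0 < Y := lt_of_lt_of_le (by positivity) hY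
  -- `2 h² ≤ Y`
  have hE : h ≤ Real.exp (ℓ ^ (3 / 4 : ℝ)) := hh.trans hHx
  have h2 : 2 * h ^ 2 ≤ Y := by
    have h3 : 2 * h ^ 2 ≤ 2 * Real.exp (ℓ ^ (3 / 4 : ℝ)) ^ 2 := by gcongr
    refine h3.trans (le_trans ?_ hY)
    rw [div_rpow_log_eq_exp hX hℓ0, ← Real.exp_nat_mul,
      show (2 : ℝ) = Real.exp (Real.log 2) by rw [Real.exp_log (by norm_num)], ← Real.exp_add]
    exact Real.exp_le_exp.2 (by push_cast; linarith)
  -- square both sides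
  have hU0 : 0 ≤ Y / h := by positivity
  rw [← pow_le_pow_iff_left₀ (Real.rpow_nonneg hY0.le _) hU0 two_ne_zero,
    ← Real.rpow_natCast, ← Real.rpow_mul hY0.le]
  norm_num
  rw [div_pow, le_div_iff₀ (by positivity)]
  nlinarith

/-- (b') Eventually `ℓ^{3/4} + 24A log ℓ ≤ ℓ`. [folklore] -/
theorem eventually_cond_b33 {A : ℝ} (hA : 0 < A) :
    ∀ᶠ X : ℕ in atTop, Real.log X ^ (3 / 4 : ℝ) + 24 * A * Real.log (Real.log X) ≤ Real.log X := by
  filter_upwards [eventually_loglog_le_mul_log (by positivity : 0 < 1 / (48 * A)),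
    eventually_rpow_log_le_mul_log (by norm_num : (3 / 4 : ℝ) < 1) (by norm_num : (0 : ℝ) < 1 / 2)]
    with X h1 h2
  have h3 : 24 * A * Real.log (Real.log X) ≤ Real.log X / 2 := by
    calc 24 * A * Real.log (Real.log X) ≤ 24 * A * (1 / (48 * A) * Real.log X) :=
          mul_le_mul_of_nonneg_left h1 (by positivity)
      _ = Real.log X / 2 := by field_simp; ring
  linarith

/-- (d') Eventually `log 2 + 2ℓ^{3/4} + 6A log ℓ ≤ ℓ`. [folklore] -/
theorem eventually_cond_d33 {A : ℝ} (hA : 0 < A) :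
    ∀ᶠ X : ℕ in atTop, Real.log 2 + 2 * Real.log X ^ (3 / 4 : ℝ) + 6 * A * Real.log (Real.log X)
      ≤ Real.log X := by
  filter_upwards [eventually_cond_a hA,
    eventually_rpow_log_le_mul_log (by norm_num : (3 / 4 : ℝ) < 1) (by norm_num : (0 : ℝ) < 1 / 4)]
    with X h1 h2
  linarith

/-- Logarithms of the integer points of `[Y/2, 3Y]`, `Y ≤ 2X`: `ℓ/2 ≤ log N ≤ 2ℓ`. [folklore] -/
theorem log_point_bounds6 {X A N : ℝ} (hX : 1 < X) (hℓ2 : 2 ≤ Real.log X)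
    (hG : Real.log 2 + 6 * A * Real.log (Real.log X) ≤ Real.log X / 2)
    (hN1 : X / (2 * Real.log X ^ (6 * A)) ≤ N) (hN2 : N ≤ 6 * X) :
    Real.log X / 2 ≤ Real.log N ∧ Real.log N ≤ 2 * Real.log X := by
  have hX0 : 0 < X := by linarith
  have hℓ0 : 0 < Real.log X := by linarith
  have h6 : 0 < Real.log X ^ (6 * A) := Real.rpow_pos_of_pos hℓ0 _
  have hN0 : 0 < N := lt_of_lt_of_le (by positivity) hN1
  constructor
  · have h1 : Real.log (X / (2 * Real.log X ^ (6 * A))) ≤ Real.log N := Real.log_le_log (by positivity) hN1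
    rw [Real.log_div hX0.ne' (by positivity), Real.log_mul (by norm_num) h6.ne',
      Real.log_rpow hℓ0] at h1
    linarith
  · have h1 : Real.log N ≤ Real.log (6 * X) := Real.log_le_log hN0 hN2
    rw [Real.log_mul (by norm_num) hX0.ne'] at h1
    have h3 : Real.log 6 ≤ 2 := by
      -- `6 ≤ e²` as `e > 2.7`
      rw [Real.log_le_iff_le_exp (by norm_num)]
      have he : (2.7 : ℝ) < Real.exp 1 := lt_trans (by norm_num) Real.exp_one_gt_d9
      have h8 : Real.exp 2 = Real.exp 1 ^ 2 := by
        rw [← Real.exp_nat_mul]; norm_num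
      rw [h8]; nlinarith
    linarith

/-! ### Lemma 4.8 at the points of `[Y/2, 3Y]`, printed regime, general `K` -/

/-- The Lemma-4.8 bound at the integer points of `[Y/2, 3Y]` with `(2A, K)` for `(A, K)`, in the
printed regime (`H ≤ exp(ℓ^{3/4})`): `q ≤ ℓ^A ≤ (log N)^{2A}`, and the sieving primes lie in
`(q, N^{1/log log N})` as `P₁ = ℓ^{c'A} > ℓ^A ≥ q`, `c' > 1`, and `Q_j ≤ exp(ℓ^{max(3/4, 1-δ/2)})`.
[cite: Lichtman2020, §5, proof of Proposition 3.4, (5.3)] -/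
theorem lemma48_at_points' {c' A δ K C₈ Y : ℝ} {X : ℕ} {H : ℕ → ℕ} {q : ℕ} (χ : DirichletCharacter ℂ q)
    (hc' : 1 < c') (hA : 0 < A) (hδ : 0 < δ)
    (h8 : ∀ x : ℝ, 3 ≤ x → ∀ q : ℕ, 1 ≤ q → (q : ℝ) ≤ Real.log x ^ (2 * A) →
      ∀ χ : DirichletCharacter ℂ q, ∀ P : Finset ℕ,
        (∀ p ∈ P, p.Prime ∧ (q : ℝ) < p ∧ (p : ℝ) < x ^ (1 / Real.log (Real.log x))) →
        ‖∑ m ∈ (Icc 1 ⌊x⌋₊).filter (fun m => ∀ p ∈ P, ¬ p ∣ m),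
            ((liouville m : ℤ) : ℂ) * χ (m : ZMod q)‖ ≤ C₈ * x / Real.log x ^ K)
    (hX1 : (1 : ℝ) < X) (hℓ4 : 4 ≤ Real.log X)
    (hHX : (H X : ℝ) ≤ Real.exp (Real.log X ^ (3 / 4 : ℝ)))
    (hGa : Real.log 2 + 6 * A * Real.log (Real.log X) ≤ Real.log X / 2)
    (hGe : A * Real.log (Real.log X) + 1 ≤ Real.log X ^ (2 / 3 : ℝ))
    (hGf : 8 * Real.log (Real.log X) * Real.log X ^ (max (3 / 4 : ℝ) (1 - δ / 2)) < Real.log X)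
    (hq : 1 ≤ q) (hqA : (q : ℝ) ≤ Real.log X ^ A)
    (hY1 : (X : ℝ) / Real.log X ^ (6 * A) ≤ Y) (hY2 : Y ≤ 2 * X) :
    ∀ N : ℕ, Y / 2 ≤ N → (N : ℝ) ≤ 3 * Y → ∀ P : Finset ℕ,
      P ⊆ IntervalSieve.primesIcc (Real.log X ^ (c' * A)) ((H X : ℝ) / Real.log X ^ (4 * A))
        ∪ IntervalSieve.primesIcc (Real.exp (Real.log X ^ (2 / 3 + δ / 2))) (Real.exp (Real.log X ^ (1 - δ / 2))) →
      ‖∑ m ∈ (Icc 1 N).filter (fun m => ∀ p ∈ P, ¬ p ∣ m),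
          ((liouville m : ℤ) : ℂ) * χ (m : ZMod q)‖ ≤ max C₈ 0 * N / Real.log N ^ K := by
  intro N hN1 hN2 P hP
  set ℓ := Real.log X with hℓdef
  have hℓ0 : 0 < ℓ := by linarith
  have hℓ1 : 1 < ℓ := by linarith
  have hX0 : (0 : ℝ) < X := by linarith
  have h6 : 0 < ℓ ^ (6 * A) := Real.rpow_pos_of_pos hℓ0 _
  have hN1' : (X : ℝ) / (2 * Real.log X ^ (6 * A)) ≤ N := by
    have : (X : ℝ) / (2 * Real.log X ^ (6 * A)) = X / Real.log X ^ (6 * A) / 2 := by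
      rw [div_div, mul_comm]
    rw [this]; linarith
  have hN2' : (N : ℝ) ≤ 6 * X := hN2.trans (by linarith)
  obtain ⟨hlo, hhi⟩ := log_point_bounds6 hX1 (by linarith) hGa hN1' hN2'
  have hN0 : (0 : ℝ) < N := lt_of_lt_of_le (by
    have : 0 < (X : ℝ) / (2 * Real.log X ^ (6 * A)) := by positivity
    exact this) hN1'
  have hN3 : (3 : ℝ) ≤ N := by
    -- `log N ≥ ℓ/2 ≥ 2 > log 3`
    by_contra hcon
    push Not at hcon
    have h1 : Real.log N < Real.log 3 := Real.log_lt_log hN0 hcon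
    have h2 : Real.log 3 ≤ 2 := by
      have := Real.log_le_sub_one_of_pos (by norm_num : (0 : ℝ) < 3); linarith
    linarith
  have hq2 : (q : ℝ) ≤ Real.log N ^ (2 * A) := hqA.trans (rpow_le_rpow_log_point hℓ4 hA.le hlo)
  -- the sieving primes
  set E₀ := max (3 / 4 : ℝ) (1 - δ / 2) with hE₀
  have hexpE : ∀ {u : ℝ}, u ≤ E₀ → Real.exp (ℓ ^ u) ≤ Real.exp (ℓ ^ E₀) := fun hu =>
    Real.exp_le_exp.2 (Real.rpow_le_rpow_of_exponent_le hℓ1.le hu)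
  have hHE : (H X : ℝ) ≤ Real.exp (ℓ ^ E₀) := hHX.trans (hexpE (le_max_left _ _))
  have hqℓ : (q : ℝ) < ℓ ^ (c' * A) :=
    lt_of_le_of_lt hqA ((Real.rpow_lt_rpow_left_iff hℓ1).2 (by nlinarith))
  have hqP₂ : (q : ℝ) < Real.exp (ℓ ^ (2 / 3 + δ / 2)) := by
    refine lt_of_le_of_lt hqA ?_
    rw [Real.rpow_def_of_pos hℓ0, Real.exp_lt_exp]
    have h1 : ℓ ^ (2 / 3 : ℝ) ≤ ℓ ^ (2 / 3 + δ / 2) :=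
      Real.rpow_le_rpow_of_exponent_le hℓ1.le (by linarith)
    nlinarith
  have hPcond : ∀ p ∈ P, p.Prime ∧ (q : ℝ) < p ∧ (p : ℝ) < (N : ℝ) ^ (1 / Real.log (Real.log N)) := by
    intro p hp
    have hp' := hP hp
    rw [Finset.mem_union, IntervalSieve.mem_primesIcc, IntervalSieve.mem_primesIcc] at hp'
    rcases hp' with ⟨hpr, hP1, hQ1⟩ | ⟨hpr, hP2, hQ2⟩
    · refine ⟨hpr, hqℓ.trans_le hP1, lt_rpow_inv_loglog hℓ4 hN0 hlo hhi ?_ hGf⟩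
      have h4 : 1 ≤ ℓ ^ (4 * A) := Real.one_le_rpow hℓ1.le (by positivity)
      have hH0 : (0 : ℝ) ≤ H X := Nat.cast_nonneg _
      exact hQ1.trans ((div_le_self hH0 h4).trans hHE)
    · exact ⟨hpr, hqP₂.trans_le hP2,
        lt_rpow_inv_loglog hℓ4 hN0 hlo hhi (hQ2.trans (hexpE (le_max_right _ _))) hGf⟩
  have key := h8 N hN3 q hq hq2 χ P hPcond
  rw [Nat.floor_natCast] at key
  refine key.trans ?_
  have hK0 : 0 ≤ Real.log N ^ K := Real.rpow_nonneg (by linarith) _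
  exact div_le_div_of_nonneg_right (mul_le_mul_of_nonneg_right (le_max_left _ _) hN0.le) hK0

end Lichtman2020

/-! ### Proposition 3.4 at the printed first exponent, all window lengths -/

-- The assembly below is long but linear (ten filters, two piece bounds, numerics).
set_option maxHeartbeats 800000 in
open Lichtman2020 ArithmeticFunction in
/-- **Lichtman 2020, Proposition 3.4 along `S_c` (`c ≥ 33`), printed regime, every window length,
from Proposition 5.1 (saving `(log X)^{-3A}`) and Lemma 4.8** ("Proof of Proposition 3.4 from
Proposition 5.1", p. 14), stated with the two inputs as hypotheses: `h51` is the conclusion of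
`Lichtman2020.dirichletMeanValue33` for these `c, A, δ, H`, `h48` is the named fact
`Lichtman2020_liouvilleCharacterSifted` (Lemma 4.8, proved in the tree).  With `ℓ = log X`,
`T₀ = ℓ^{6A}`, `h₂ = Y/T₀³`, `K = 20A`: the long windows are `≤ η = 24C₈Y/(ℓ/2)^K`, the two
Proposition-5.1 bounds (for `χ`, `χ⁻¹` at the scale `Y`) feed `meanSquare_le_of_pieces_trunc`, and
`numerics33_final` gives the constant `24·2431²(4004 + 36C₅) + 2(24C₈2^{20A})²`.
[cite: Lichtman2020, Proposition 3.4] -/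
theorem Lichtman2020.liouvilleMeanSquare33_of {c A δ : ℝ} {H : ℕ → ℕ} (hc : 33 ≤ c) (hA : 5 < A)
    (hδ : 0 < δ)
    (hψ : ∀ᶠ X : ℕ in atTop, Real.log (H X) / Real.log (Real.log X) ≤ Real.log X ^ (2 / 3 : ℝ))
    (h51 : ∃ C : ℝ, ∀ᶠ X : ℕ in atTop, ∀ q : ℕ, 1 ≤ q → (q : ℝ) ≤ Real.log X ^ A →
      ∀ χ : DirichletCharacter ℂ q, ∀ Y : ℝ, (X : ℝ) / Real.log X ^ (6 * A) ≤ Y → Y ≤ 2 * X →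
        ∀ T : ℝ, 0 ≤ T → T ≤ 2 * X →
          ∫ t in (Real.log X ^ (6 * A))..T,
              ‖∑ n ∈ (Icc ⌈Y⌉₊ ⌊2 * Y⌋₊).filter (lichtmanTypicalWith c X A δ (H X)),
                  ((liouville n : ℤ) : ℂ) * χ (n : ZMod q) *
                    (n : ℂ) ^ (-(1 + (t : ℂ) * Complex.I))‖ ^ 2
            ≤ C * (((H X : ℝ) / Real.log X ^ (4 * A)) * T / Y + 1) / Real.log X ^ (3 * A))
    (h48 : Lichtman2020_liouvilleCharacterSifted) :
    ∃ C : ℝ, ∀ᶠ X : ℕ in atTop, ∀ q : ℕ, 1 ≤ q → (q : ℝ) ≤ Real.log X ^ A →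
      ∀ χ : DirichletCharacter ℂ q, ∀ h : ℕ, 1 ≤ h → h ≤ H X →
        ∀ Y : ℝ, (X : ℝ) / Real.log X ^ (6 * A) ≤ Y → Y ≤ 2 * X →
          ∫ x in Y..2 * Y,
              ‖∑ m ∈ (Icc ⌈x⌉₊ ⌊x + h⌋₊).filter (lichtmanTypicalWith c X A δ (H X)),
                  ((liouville m : ℤ) : ℂ) * χ (m : ZMod q)‖ ^ 2
            ≤ C * ((h : ℝ) ^ 2 * Y * ((H X : ℝ) / Real.log X ^ (4 * A) / h + 1) / Real.log X ^ (3 * A)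
              + h * Y) := by
  have hA0 : 0 < A := by linarith
  have hc1 : 1 < c := by linarith
  obtain ⟨C₅, h5⟩ := h51
  obtain ⟨C₈, h8⟩ := h48 (2 * A) (20 * A) (by linarith) (by linarith)
  have hC₅'0 : 0 ≤ max C₅ 0 := le_max_right _ _
  have hC₈'0 : 0 ≤ max C₈ 0 := le_max_right _ _
  have hE₀1 : max (3 / 4 : ℝ) (1 - δ / 2) < 1 := max_lt (by norm_num) (by linarith)
  refine ⟨24 * 2431 ^ 2 * (4004 + 36 * max C₅ 0) + 2 * (24 * max C₈ 0 * 2 ^ (20 * A)) ^ 2, ?_⟩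
  filter_upwards [h5, eventually_H_le_exp_of_psi hψ (e := 3 / 4) (by norm_num), eventually_cond_a hA0,
    eventually_cond_b33 hA0, eventually_cond_d33 hA0, eventually_cond_e hA0, eventually_cond_f hE₀1,
    tendsto_log_natCast.eventually_ge_atTop (4 * 3 + 8), eventually_ge_atTop 3]
    with X h5X hHX hGa hGb hGd hGe hGf hℓbig hX3
  intro q hq hqA χ h hh1 hh2 Y hY1 hY2
  -- the scale `ℓ = log X`
  set ℓ := Real.log X with hℓdef
  have hℓ4 : 4 ≤ ℓ := by linarith
  have hℓ1 : 1 ≤ ℓ := by linarith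
  have hℓ0 : 0 < ℓ := by linarith
  have hX3' : (3 : ℝ) ≤ X := by exact_mod_cast hX3
  have hX0 : (0 : ℝ) < X := by linarith
  have hX1 : (1 : ℝ) < X := by linarith
  have hXexp : Real.exp ℓ = X := Real.exp_log hX0
  -- `h`
  have hh2r : (h : ℝ) ≤ H X := by exact_mod_cast hh2
  have hh1' : (1 : ℝ) ≤ h := by exact_mod_cast hh1
  have hh0 : (0 : ℝ) < h := by linarith
  -- `Y`
  have hGa' : 6 * A * Real.log ℓ ≤ ℓ / 2 := by
    have : (0 : ℝ) ≤ Real.log 2 := Real.log_nonneg (by norm_num); linarith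
  have hYℓ : ℓ / 2 ≤ Y := (half_log_le_div_rpow hXexp hℓ0 hGa').trans hY1
  have hY2' : 2 ≤ Y := by linarith
  have hY1' : 1 ≤ Y := by linarith
  have hY0 : 0 < Y := by linarith
  -- `T₀`, `h₂`, `U`
  have hT₀1 : 1 ≤ ℓ ^ (6 * A) := Real.one_le_rpow hℓ1 (by positivity)
  have hhh₂ : (h : ℝ) ≤ Y / (ℓ ^ (6 * A)) ^ 3 := h_le_h₂33 hXexp hℓ1 hh2r hHX hY1 hGb
  have hh₂0 : 0 ≤ Y / (ℓ ^ (6 * A)) ^ 3 := by positivity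
  have hh₂Y : Y / (ℓ ^ (6 * A)) ^ 3 ≤ Y := div_le_self hY0.le (one_le_pow₀ hT₀1)
  have hhY : (h : ℝ) ≤ Y := hhh₂.trans hh₂Y
  have hT₀U : ℓ ^ (6 * A) ≤ Y / h := T₀_le_U33 hXexp hℓ1 hA0.le hh0 hh2r hHX hY1 hGb
  have hU : Y ^ (1 / 2 : ℝ) ≤ Y / h := sqrt_le_U33 hXexp hℓ1 hh0 hh2r hHX hY1 hGd
  have hQ0 : (0 : ℝ) ≤ H X / ℓ ^ (4 * A) := by positivity
  have hℓ3 : 0 < ℓ ^ (3 * A) := Real.rpow_pos_of_pos hℓ0 _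
  have hL0 : (0 : ℝ) ≤ 1 / ℓ ^ (3 * A) := by positivity
  have hη0 : 0 ≤ 24 * max C₈ 0 * Y / (ℓ / 2) ^ (20 * A) := by positivity
  -- the long windows ((5.3))
  have h8' := lemma48_at_points' (K := 20 * A) χ hc1 hA0 hδ h8 hX1 hℓ4 hHX hGa hGe hGf hq hqA hY1 hY2
  have hlogN : ∀ N : ℕ, Y / 2 ≤ N → (N : ℝ) ≤ 3 * Y → ℓ / 2 ≤ Real.log N := by
    intro N hN1 hN2
    have hN1' : (X : ℝ) / (2 * Real.log X ^ (6 * A)) ≤ N := by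
      have : (X : ℝ) / (2 * Real.log X ^ (6 * A)) = X / Real.log X ^ (6 * A) / 2 := by
        rw [div_div, mul_comm]
      rw [this]; linarith
    exact (log_point_bounds6 hX1 (by linarith) hGa hN1' (hN2.trans (by linarith))).1
  have hS₂ : ∀ x ∈ Set.Icc Y (2 * Y),
      ‖∑ m ∈ (Finset.Icc ⌈x⌉₊ ⌊x + Y / (ℓ ^ (6 * A)) ^ 3⌋₊).filter
        (lichtmanTypicalWith c X A δ (H X)),
        ((liouville m : ℤ) : ℂ) * χ (m : ZMod q)‖ ≤ 24 * max C₈ 0 * Y / (ℓ / 2) ^ (20 * A) :=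
    fun x hx => norm_longWindow_le χ hY2' hh₂0 hh₂Y hx hC₈'0 (by positivity) (by linarith) hlogN h8'
  -- the two Proposition-5.1 bounds at the scale `Y`
  have hY2X : Y ≤ 2 * (X : ℝ) := hY2
  haveI : NeZero q := ⟨by omega⟩
  have hP₁ : DirichletPieceBound (lichtmanTypicalWith c X A δ (H X))
      (fun n => ((liouville n : ℤ) : ℂ) * χ (n : ZMod q)) Y (ℓ ^ (6 * A)) (max C₅ 0)
      (H X / ℓ ^ (4 * A)) (1 / ℓ ^ (3 * A)) :=
    pieceBound_of_prop51 hℓ3 hY0 hY2X hQ0 fun T hT1 hT2 => h5X q hq hqA χ Y hY1 hY2X T hT1 hT2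
  have hP₃ : DirichletPieceBound (lichtmanTypicalWith c X A δ (H X))
      (fun n => star (((liouville n : ℤ) : ℂ) * χ (n : ZMod q))) Y (ℓ ^ (6 * A)) (max C₅ 0)
      (H X / ℓ ^ (4 * A)) (1 / ℓ ^ (3 * A)) := by
    rw [star_liouville_mul_char χ]
    exact pieceBound_of_prop51 hℓ3 hY0 hY2X hQ0
      fun T hT1 hT2 => h5X q hq hqA χ⁻¹ Y hY1 hY2X T hT1 hT2
  -- the skeleton
  have main := meanSquare_le_of_pieces_trunc (lichtmanTypicalWith c X A δ (H X))
    (c := fun n => ((liouville n : ℤ) : ℂ) * χ (n : ZMod q)) (norm_liouville_mul_char_le χ)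
    hY1' hT₀1 hh1' hhh₂ le_rfl hη0 hC₅'0 hQ0 hL0 hT₀U hU hS₂ hP₁ hP₃
  refine main.trans ?_
  -- numerics
  rw [numerics_eta33 hℓ1 hY0]
  have hE : (0 : ℝ) ≤ 2 * (24 * max C₈ 0 * 2 ^ (20 * A)) ^ 2 := by positivity
  exact numerics33_final hℓ1 hA0.le hh1' hhY hC₅'0 hQ0 hE

/-- **Lichtman 2020, Proposition 3.4 along `S_c` (`c ≥ 33`) in the printed regime, every window
length, saving `(log X)^{-3A}`** — PROVED from the named fact Lemma 4.5
(`Lichtman2020_primeCharacterSum`, via `Lichtman2020.dirichletMeanValue33`) and the named fact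
Lemma 4.8 (`Lichtman2020_liouvilleCharacterSifted`, proved in the tree as
`Lichtman2020_liouvilleCharacterSifted_holds`): for `q ≤ (log X)^A`, `χ (mod q)`, `1 ≤ h ≤ H`,
`Y ∈ [X/(log X)^{6A}, 2X]`,
`∫_Y^{2Y} |∑_{x ≤ m ≤ x+h, m ∈ S_c} λ(m)χ(m)|² dx ≤ C (h²Y(Q₁/h + 1)(log X)^{-3A} + hY)`.
[cite: Lichtman2020, Proposition 3.4] -/
theorem Lichtman2020.liouvilleMeanSquare33 (h45 : Lichtman2020_primeCharacterSum)
    (h48 : Lichtman2020_liouvilleCharacterSifted) :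
    ∀ c : ℝ, 33 ≤ c → ∀ A : ℝ, 5 < A → ∀ δ : ℝ, 0 < δ → ∀ H : ℕ → ℕ,
    Tendsto (fun X : ℕ => Real.log (H X) / Real.log (Real.log X)) atTop atTop →
    (∀ᶠ X : ℕ in atTop, Real.log (H X) / Real.log (Real.log X) ≤ Real.log X ^ (2 / 3 : ℝ)) →
    ∃ C : ℝ, ∀ᶠ X : ℕ in atTop, ∀ q : ℕ, 1 ≤ q → (q : ℝ) ≤ Real.log X ^ A →
      ∀ χ : DirichletCharacter ℂ q, ∀ h : ℕ, 1 ≤ h → h ≤ H X →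
        ∀ Y : ℝ, (X : ℝ) / Real.log X ^ (6 * A) ≤ Y → Y ≤ 2 * X →
          ∫ x in Y..2 * Y,
              ‖∑ m ∈ (Icc ⌈x⌉₊ ⌊x + h⌋₊).filter (lichtmanTypicalWith c X A δ (H X)),
                  ((ArithmeticFunction.liouville m : ℤ) : ℂ) * χ (m : ZMod q)‖ ^ 2
            ≤ C * ((h : ℝ) ^ 2 * Y * ((H X : ℝ) / Real.log X ^ (4 * A) / h + 1) / Real.log X ^ (3 * A)
              + h * Y) :=
  fun c hc A hA δ hδ H hH hψ =>
    Lichtman2020.liouvilleMeanSquare33_of hc hA hδ hψ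
      (Lichtman2020.dirichletMeanValue33 h45 c hc A hA δ hδ H hH hψ) h48

end Literature.NumberTheory.Sieve
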